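import Summits.ResolutionOfSingularities.ResolutionOfSingularities.Theorems.FrobeniusClosingSteerCore4SteeredRunExists
import Literature.AlgebraicGeometry.Resolution.ValuedFunctionFields
import Literature.AlgebraicGeometry.Resolution.QuadraticTransforms
import Literature.AlgebraicGeometry.Resolution.RsopMonomialIdeals
import Mathlib.RingTheory.AdjoinRoot
import Mathlib.FieldTheory.Perfect
import Mathlib.RingTheory.AlgebraicIndependent.Basic
import Mathlib.RingTheory.Derivation.Basic
import Mathlib.RingTheory.KrullDimension.Basic
import HarnessLib

/-!
# Crux `Steer` (stmt-ResolutionOfSingularities-16345), chain W4.1, R2 σ_top line: piece **E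
# `SteeredRunExists`, LITERALLY** (`L/w41/Sketch-R2-steered.lean` fb4f9514a6cb98fe §3.4)

OURS (campaign `res-hironaka`, rung L, slot W4.1, chain W4.1, unit `res-L0-w41-stub-8` carried by
`res-D-pv-012`; replaces the role of no printed item; NOT a statement of the manuscript under review;
AI-produced, weaker than expert review). Sequel of `FrobeniusClosingSteerCore4SteeredRunExists.lean`
(the content, `SteeredRun.steeredRun_dichotomy`): here the planner's piece E is stated with EVERY binder of
the sketch's `CoreDatum` and with the sketch's vocabulary (`ZeroDim`, `Discrete`, `DenseAbhyankar`,
`IsFracOf`, `StronglySwitching`, `ArchSeq`, `Defect`; `IsSingPrime`, `IsTopSingComponent`,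
`IsPermissibleCentre`, `IsSigmaTopCentre`, `IsExcParamAlong`, `IsStrictStepAlong`, `IsSteeredRunUpTo`,
`IsSteeredRun`, `SteeredExitAt`, `SteeredStallAt`) UNFOLDED verbatim, so that once the holder pastes the
sketch into the line's skeleton the leaf `E` is `SteeredRun.steeredRunExists` by `defeq` (kernel-checked
against a verbatim replica of the sketch's §1/§3 definitions). The proof is the three-line instantiation of
`steeredRun_dichotomy`. No definitions. [cite: NovacoskiSpivakovsky2014, Def. 2.11] [folklore]
-/

set_option linter.dupNamespace false -- layout-mandated `Summit.<S>.<S>.…` (single-conjunct summit)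

open IsLocalRing Literature.AlgebraicGeometry.Resolution

namespace Summit.ResolutionOfSingularities.ResolutionOfSingularities.Theorems.SwitchingDichotomy

namespace SteeredRun

/-! ## Piece E, literally (sketch vocabulary unfolded verbatim) -/

section Literal

/-- **E · `SteeredRunExists`, the literal piece** of the R2 σ_top sub-plan (`L/w41/Sketch-R2-steered.lean`
fb4f9514a6cb98fe §3.4, planner res-L0-w41-plan-1): from the core datum (`CoreDatum p n k K O A₀ h₀ t`, all
fourteen r10 binders, here as the hypothesis list verbatim), σ_top reaches an EXIT or a STALL at some finite
stage, or runs for ever — with the sketch's `IsSingPrime`, `IsTopSingComponent`, `IsPermissibleCentre`,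
`IsSigmaTopCentre`, `IsExcParamAlong`, `IsStrictStepAlong`, `IsSteeredRunUpTo`, `IsSteeredRun`,
`SteeredExitAt`, `SteeredStallAt` (and `ZeroDim`, `Discrete`, `DenseAbhyankar`, `IsFracOf`,
`StronglySwitching`, `ArchSeq`, `Defect` inside the core datum) UNFOLDED, so that the by-name leaf of a
reshaped skeleton is `SteeredRun.steeredRunExists` by `defeq`. Only `A₀.FG`, `t ^ p ∈ A₀`, regularity at
the centre and «`t ^ p` is not a `p`-th power there» are used (`steeredRun_dichotomy`); the other binders
certify the regime. [cite: NovacoskiSpivakovsky2014, Def. 2.11] [folklore] -/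
theorem steeredRunExists :
    ∀ p : ℕ, p.Prime → ∀ n : ℕ, 4 ≤ n →
    ∀ (k K : Type) [Field k] [CharP k p] [PerfectField k] [Field K] [Algebra k K]
    (O : ValuationSubring K) (A₀ : Subalgebra k K) (h₀ : A₀.toSubring ≤ O.toSubring) (t : K),
    (A₀.FG ∧ ∃ htp : t ^ p ∈ A₀, IsFractionRing (Algebra.adjoin k (insert t (A₀ : Set K))) K ∧
      IsRegularLocalRing (Localization.AtPrime
        (Ideal.comap (Subring.inclusion h₀) (IsLocalRing.maximalIdeal O))) ∧
      (Ideal.comap (Subring.inclusion h₀) (IsLocalRing.maximalIdeal O)).IsMaximal ∧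
      (∀ x ∈ O, ∃ f : Polynomial k, f ≠ 0 ∧ Polynomial.aeval x f ∈ O.nonunits) ∧
      ¬ ringKrullDim (Localization.AtPrime
        (Ideal.comap (Subring.inclusion h₀) (IsLocalRing.maximalIdeal O))) ≤ 2 ∧
      ¬ IsAbhyankarPlace O (algebraMap k K).fieldRange ⊤ ∧
      ¬ (∃ F₀ : Subfield K, (algebraMap k K).fieldRange ≤ F₀ ∧ FGOver (algebraMap k K).fieldRange F₀ ∧
          IsAbhyankarPlace O (algebraMap k K).fieldRange F₀ ∧
          ∀ x w : K, w ≠ 0 → ∃ a ∈ F₀, O.valuation (x - a) < O.valuation w) ∧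
      ¬ (∃ π : K, π ≠ 0 ∧ O.valuation π < 1 ∧
          ∀ z : K, z ≠ 0 → ∃ n : ℤ, O.valuation z = O.valuation π ^ n) ∧
      (∀ δ : Derivation ℤ (Localization.AtPrime (Ideal.comap (Subring.inclusion h₀)
          (IsLocalRing.maximalIdeal O))) (Localization.AtPrime (Ideal.comap (Subring.inclusion h₀)
          (IsLocalRing.maximalIdeal O))),
        ¬ IsUnit (δ (algebraMap A₀.toSubring (Localization.AtPrime (Ideal.comap (Subring.inclusion h₀)
          (IsLocalRing.maximalIdeal O))) ⟨t ^ p, htp⟩))) ∧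
      (∀ c : Localization.AtPrime (Ideal.comap (Subring.inclusion h₀) (IsLocalRing.maximalIdeal O)),
        algebraMap A₀.toSubring (Localization.AtPrime (Ideal.comap (Subring.inclusion h₀)
          (IsLocalRing.maximalIdeal O))) ⟨t ^ p, htp⟩ ≠ c ^ p) ∧
      Algebra.trdeg k K = (n : Cardinal) ∧
      ¬ ((∀ R : ℕ → Subring K, R 0 = locAtCentre A₀.toSubring O →
            (∀ i, IsQuadraticTransformAlong O (R i) (R (i + 1))) →
            ∀ x : K, x ∈ O → (∃ y ∈ A₀, ∃ z ∈ A₀, z ≠ 0 ∧ x = y / z) → ∃ i, x ∈ R i) ∧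
         (∀ R : ℕ → Subring K, R 0 = locAtCentre A₀.toSubring O →
            (∀ i, IsQuadraticTransformAlong O (R i) (R (i + 1))) →
            ∀ y : K, (∃ y' ∈ A₀, ∃ z ∈ A₀, z ≠ 0 ∧ y = y' / z) → y ≠ 0 → O.valuation y < 1 →
              ∃ (i : ℕ) (_ : IsLocalRing (R i)) (z : Fin 1 → R i), IsRsopPart z ∧
                ∃ n : ℕ, O.valuation ((z 0 : R i) : K) ^ n < O.valuation y) ∧
         ¬ (∀ g : K, (∃ y ∈ A₀, ∃ z ∈ A₀, z ≠ 0 ∧ g = y / z) →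
            ∃ w : K, (∃ y ∈ A₀, ∃ z ∈ A₀, z ≠ 0 ∧ w = y / z) ∧
              O.valuation (t ^ p - g ^ p) = O.valuation (w ^ p)))) →
    (∃ (R : ℕ → Subring K) (P : (i : ℕ) → Ideal (R i)) (s : ℕ → K) (N : ℕ),
        R 0 = locAtCentre A₀.toSubring O ∧
        (s 0 = t ∧ (∀ i ≤ N, s i ^ p ∈ R i) ∧ ∀ i < N, ∃ (_ : IsLocalRing (R i)) (hs : s i ^ p ∈ R i),
          ((P i ≠ maximalIdeal (R i) ∧
              (∃ _ : (P i).IsPrime,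
                (¬ IsRegularLocalRing (AdjoinRoot (Polynomial.X ^ p - Polynomial.C
                  (algebraMap (R i) (Localization.AtPrime (P i)) ⟨s i ^ p, hs⟩)))) ∧
                (∀ (Q : Ideal (R i)) [Q.IsPrime],
                  (¬ IsRegularLocalRing (AdjoinRoot (Polynomial.X ^ p - Polynomial.C
                    (algebraMap (R i) (Localization.AtPrime Q) ⟨s i ^ p, hs⟩)))) → Q ≤ P i → Q = P i) ∧
                (∀ (Q : Ideal (R i)) [Q.IsPrime],
                  (¬ IsRegularLocalRing (AdjoinRoot (Polynomial.X ^ p - Polynomial.C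
                    (algebraMap (R i) (Localization.AtPrime Q) ⟨s i ^ p, hs⟩)))) →
                  (∀ (Q' : Ideal (R i)) [Q'.IsPrime],
                    (¬ IsRegularLocalRing (AdjoinRoot (Polynomial.X ^ p - Polynomial.C
                      (algebraMap (R i) (Localization.AtPrime Q') ⟨s i ^ p, hs⟩)))) → Q' ≤ Q → Q' = Q) →
                  ringKrullDim (R i ⧸ Q) ≤ ringKrullDim (R i ⧸ P i))) ∧
              IsRegularLocalRing (R i ⧸ P i) ∧ ∃ g : R i, (⟨s i ^ p, hs⟩ : R i) - g ^ p ∈ P i ^ p) ∨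
            (P i = maximalIdeal (R i) ∧
              (∀ Q : Ideal (R i), ¬ (Q ≠ maximalIdeal (R i) ∧
                (∃ _ : Q.IsPrime,
                  (¬ IsRegularLocalRing (AdjoinRoot (Polynomial.X ^ p - Polynomial.C
                    (algebraMap (R i) (Localization.AtPrime Q) ⟨s i ^ p, hs⟩)))) ∧
                  (∀ (Q₁ : Ideal (R i)) [Q₁.IsPrime],
                    (¬ IsRegularLocalRing (AdjoinRoot (Polynomial.X ^ p - Polynomial.C
                      (algebraMap (R i) (Localization.AtPrime Q₁) ⟨s i ^ p, hs⟩)))) → Q₁ ≤ Q → Q₁ = Q) ∧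
                  (∀ (Q₁ : Ideal (R i)) [Q₁.IsPrime],
                    (¬ IsRegularLocalRing (AdjoinRoot (Polynomial.X ^ p - Polynomial.C
                      (algebraMap (R i) (Localization.AtPrime Q₁) ⟨s i ^ p, hs⟩)))) →
                    (∀ (Q' : Ideal (R i)) [Q'.IsPrime],
                      (¬ IsRegularLocalRing (AdjoinRoot (Polynomial.X ^ p - Polynomial.C
                        (algebraMap (R i) (Localization.AtPrime Q') ⟨s i ^ p, hs⟩)))) → Q' ≤ Q₁ → Q' = Q₁) →
                    ringKrullDim (R i ⧸ Q₁) ≤ ringKrullDim (R i ⧸ Q))) ∧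
                IsRegularLocalRing (R i ⧸ Q) ∧ ∃ g : R i, (⟨s i ^ p, hs⟩ : R i) - g ^ p ∈ Q ^ p)) ∧
              ∃ g : R i, (⟨s i ^ p, hs⟩ : R i) - g ^ p ∈ maximalIdeal (R i) ^ p)) ∧
          IsLocalBlowupAlong O (R i) (P i) (R (i + 1)) ∧
          ∃ x g : K, ((∃ hx : x ∈ R i, (⟨x, hx⟩ : R i) ∈ P i) ∧ x ≠ 0 ∧
            ∀ y : R i, y ∈ P i → O.valuation (y : K) ≤ O.valuation x) ∧ g ∈ R i ∧
            s i = x * s (i + 1) + g) ∧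
        ((∃ (_ : IsLocalRing (R N)) (hs : s N ^ p ∈ R N),
            ¬ ¬ IsRegularLocalRing (AdjoinRoot (Polynomial.X ^ p - Polynomial.C
              (algebraMap (R N) (Localization.AtPrime (maximalIdeal (R N))) ⟨s N ^ p, hs⟩)))) ∨
          (∃ (_ : IsLocalRing (R N)) (hs : s N ^ p ∈ R N),
            (¬ IsRegularLocalRing (AdjoinRoot (Polynomial.X ^ p - Polynomial.C
              (algebraMap (R N) (Localization.AtPrime (maximalIdeal (R N))) ⟨s N ^ p, hs⟩)))) ∧
            (∀ Q : Ideal (R N), ¬ (Q ≠ maximalIdeal (R N) ∧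
              (∃ _ : Q.IsPrime,
                (¬ IsRegularLocalRing (AdjoinRoot (Polynomial.X ^ p - Polynomial.C
                  (algebraMap (R N) (Localization.AtPrime Q) ⟨s N ^ p, hs⟩)))) ∧
                (∀ (Q₁ : Ideal (R N)) [Q₁.IsPrime],
                  (¬ IsRegularLocalRing (AdjoinRoot (Polynomial.X ^ p - Polynomial.C
                    (algebraMap (R N) (Localization.AtPrime Q₁) ⟨s N ^ p, hs⟩)))) → Q₁ ≤ Q → Q₁ = Q) ∧
                (∀ (Q₁ : Ideal (R N)) [Q₁.IsPrime],
                  (¬ IsRegularLocalRing (AdjoinRoot (Polynomial.X ^ p - Polynomial.C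
                    (algebraMap (R N) (Localization.AtPrime Q₁) ⟨s N ^ p, hs⟩)))) →
                  (∀ (Q' : Ideal (R N)) [Q'.IsPrime],
                    (¬ IsRegularLocalRing (AdjoinRoot (Polynomial.X ^ p - Polynomial.C
                      (algebraMap (R N) (Localization.AtPrime Q') ⟨s N ^ p, hs⟩)))) → Q' ≤ Q₁ → Q' = Q₁) →
                  ringKrullDim (R N ⧸ Q₁) ≤ ringKrullDim (R N ⧸ Q))) ∧
              IsRegularLocalRing (R N ⧸ Q) ∧ ∃ g : R N, (⟨s N ^ p, hs⟩ : R N) - g ^ p ∈ Q ^ p)) ∧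
            ∀ g : R N, (⟨s N ^ p, hs⟩ : R N) - g ^ p ∉ maximalIdeal (R N) ^ p))) ∨
      (∃ (R : ℕ → Subring K) (P : (i : ℕ) → Ideal (R i)) (s : ℕ → K),
        R 0 = locAtCentre A₀.toSubring O ∧
        (s 0 = t ∧ ∀ i, ∃ (_ : IsLocalRing (R i)) (hs : s i ^ p ∈ R i),
          ((P i ≠ maximalIdeal (R i) ∧
              (∃ _ : (P i).IsPrime,
                (¬ IsRegularLocalRing (AdjoinRoot (Polynomial.X ^ p - Polynomial.C
                  (algebraMap (R i) (Localization.AtPrime (P i)) ⟨s i ^ p, hs⟩)))) ∧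
                (∀ (Q : Ideal (R i)) [Q.IsPrime],
                  (¬ IsRegularLocalRing (AdjoinRoot (Polynomial.X ^ p - Polynomial.C
                    (algebraMap (R i) (Localization.AtPrime Q) ⟨s i ^ p, hs⟩)))) → Q ≤ P i → Q = P i) ∧
                (∀ (Q : Ideal (R i)) [Q.IsPrime],
                  (¬ IsRegularLocalRing (AdjoinRoot (Polynomial.X ^ p - Polynomial.C
                    (algebraMap (R i) (Localization.AtPrime Q) ⟨s i ^ p, hs⟩)))) →
                  (∀ (Q' : Ideal (R i)) [Q'.IsPrime],
                    (¬ IsRegularLocalRing (AdjoinRoot (Polynomial.X ^ p - Polynomial.C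
                      (algebraMap (R i) (Localization.AtPrime Q') ⟨s i ^ p, hs⟩)))) → Q' ≤ Q → Q' = Q) →
                  ringKrullDim (R i ⧸ Q) ≤ ringKrullDim (R i ⧸ P i))) ∧
              IsRegularLocalRing (R i ⧸ P i) ∧ ∃ g : R i, (⟨s i ^ p, hs⟩ : R i) - g ^ p ∈ P i ^ p) ∨
            (P i = maximalIdeal (R i) ∧
              (∀ Q : Ideal (R i), ¬ (Q ≠ maximalIdeal (R i) ∧
                (∃ _ : Q.IsPrime,
                  (¬ IsRegularLocalRing (AdjoinRoot (Polynomial.X ^ p - Polynomial.C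
                    (algebraMap (R i) (Localization.AtPrime Q) ⟨s i ^ p, hs⟩)))) ∧
                  (∀ (Q₁ : Ideal (R i)) [Q₁.IsPrime],
                    (¬ IsRegularLocalRing (AdjoinRoot (Polynomial.X ^ p - Polynomial.C
                      (algebraMap (R i) (Localization.AtPrime Q₁) ⟨s i ^ p, hs⟩)))) → Q₁ ≤ Q → Q₁ = Q) ∧
                  (∀ (Q₁ : Ideal (R i)) [Q₁.IsPrime],
                    (¬ IsRegularLocalRing (AdjoinRoot (Polynomial.X ^ p - Polynomial.C
                      (algebraMap (R i) (Localization.AtPrime Q₁) ⟨s i ^ p, hs⟩)))) →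
                    (∀ (Q' : Ideal (R i)) [Q'.IsPrime],
                      (¬ IsRegularLocalRing (AdjoinRoot (Polynomial.X ^ p - Polynomial.C
                        (algebraMap (R i) (Localization.AtPrime Q') ⟨s i ^ p, hs⟩)))) → Q' ≤ Q₁ → Q' = Q₁) →
                    ringKrullDim (R i ⧸ Q₁) ≤ ringKrullDim (R i ⧸ Q))) ∧
                IsRegularLocalRing (R i ⧸ Q) ∧ ∃ g : R i, (⟨s i ^ p, hs⟩ : R i) - g ^ p ∈ Q ^ p)) ∧
              ∃ g : R i, (⟨s i ^ p, hs⟩ : R i) - g ^ p ∈ maximalIdeal (R i) ^ p)) ∧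
          IsLocalBlowupAlong O (R i) (P i) (R (i + 1)) ∧
          ∃ x g : K, ((∃ hx : x ∈ R i, (⟨x, hx⟩ : R i) ∈ P i) ∧ x ≠ 0 ∧
            ∀ y : R i, y ∈ P i → O.valuation (y : K) ≤ O.valuation x) ∧ g ∈ R i ∧
            s i = x * s (i + 1) + g)) := by
  intro p hp n _hn k K _ _ _ _ _ O A₀ h₀ t core
  obtain ⟨hfg, htp, -, hreg, -, -, -, -, -, -, -, hc, -, -⟩ := core
  exact steeredRun_dichotomy
    (fun (S : Subring K) (_ : IsLocalRing S) (f : S) => ¬ IsRegularLocalRing (AdjoinRoot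
      (Polynomial.X ^ p - Polynomial.C (algebraMap S (Localization.AtPrime (maximalIdeal S)) f))))
    (fun (S : Subring K) (_ : IsLocalRing S) (f : S) (P : Ideal S) => P ≠ maximalIdeal S ∧
      (∃ _ : P.IsPrime,
        (¬ IsRegularLocalRing (AdjoinRoot (Polynomial.X ^ p - Polynomial.C
          (algebraMap S (Localization.AtPrime P) f)))) ∧
        (∀ (Q : Ideal S) [Q.IsPrime],
          (¬ IsRegularLocalRing (AdjoinRoot (Polynomial.X ^ p - Polynomial.C
            (algebraMap S (Localization.AtPrime Q) f)))) → Q ≤ P → Q = P) ∧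
        (∀ (Q : Ideal S) [Q.IsPrime],
          (¬ IsRegularLocalRing (AdjoinRoot (Polynomial.X ^ p - Polynomial.C
            (algebraMap S (Localization.AtPrime Q) f)))) →
          (∀ (Q' : Ideal S) [Q'.IsPrime],
            (¬ IsRegularLocalRing (AdjoinRoot (Polynomial.X ^ p - Polynomial.C
              (algebraMap S (Localization.AtPrime Q') f)))) → Q' ≤ Q → Q' = Q) →
          ringKrullDim (S ⧸ Q) ≤ ringKrullDim (S ⧸ P))) ∧
      IsRegularLocalRing (S ⧸ P) ∧ ∃ g : S, f - g ^ p ∈ P ^ p)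
    p hp (fun S _ f P h => h.2.2.2) O A₀ h₀ t hfg htp hreg hc

end Literal

end SteeredRun

end Summit.ResolutionOfSingularities.ResolutionOfSingularities.Theorems.SwitchingDichotomy
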